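import Summits.BirchSwinnertonDyer.BirchSwinnertonDyer.Theorems.EdixhovenFibreFiveSevenStarredOptimalManinUnitFiveSevenAssemblyAtBar
import Summits.BirchSwinnertonDyer.BirchSwinnertonDyer.Theorems.EdixhovenFibreFiveSevenStarredOptimalManinUnitFiveSevenSemiLocalIntegralityOfRangeAt
import HarnessLib
/-!
# F″ at ONE ISOGENY CLASS, PER CURVE / PER TOWER: the assembly socket `…AssemblyAtBar` re-keyed on the body of (S5b-tower) at the
# members of the class and the towers `ℚ_v ⊆ ℚ(ζ_m)_w` (route `EdixhovenFibreFiveSeven`, crux K★ stmt-BirchSwinnertonDyer-22226, line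
# `kato-lever`; seat `bsd-line-edix-p1` g29, LEAD)

HONEST FRAMING. TOOL theorem only (no definition, no named fact, no `sorry`; file-local instance keys on `ℚ_v` byte-identical to
`…SemiLocalIntegralityPinAt` l.164–169, needed only to STATE the displayed hypothesis); nothing is closed or booked; BSD / K★ are NOT proved.
Sequel of `…TowerRangeAt` and `…SemiLocalIntegralityOfRangeAt` (memo `Lines/kato-lever-seam-rec-at-cells.md`).

* ★★ `katoNeronBody_of_sl2NeronValuesBar_of_rangeAt` — the body of F″ at `(V, p)` ⟸ P1-bar ∧ hP ∧ hDRV ∧ `hT₂V`, where `hT₂V` is the body of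
  (S5b-tower) at every globally minimal member `W′ ∼ V` and every `w ∣ p` of `ℚ(ζ_m)` — the statement of
  `katoNeronBody_of_sl2NeronValuesBar_of_isDeRhamAt` with `hT₂` so replaced.

References: [Kato2004Asterisque] (8.1.3) p. 180, §8.3, Thm. 9.7, Thm. 6.6 (1), Thm. 5.6, Thm. 13.6; [Kato1993LNM1553] Ch. II Prop. 1.2.3,
Ex. 1.3.5, Thm. 1.4.1; [BlochKato1990] Prop. 3.8, Ex. 3.11; [KimNakamura2020] Cor. 2.4; [GreenbergVatsal2000] §3 Remark 3.4; [AtkinLehner1970] Thm. 3.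
-/

set_option autoImplicit false
-- the Theorems namespace of a single-conjunct summit repeats the summit name by design (D-0017)
set_option linter.dupNamespace false

noncomputable section

namespace Summit.BirchSwinnertonDyer.BirchSwinnertonDyer.Theorems.StarredOptimalManinUnitFiveSevenAssemblyAtBarOfRangeAt

open scoped MatrixGroups ModularForm Classical NumberField TensorProduct
open Complex CongruenceSubgroup WeierstrassCurve IsDedekindDomain NumberField
open Field ValuativeRel
open Literature.NumberTheory.GaloisRepresentations
open Literature.NumberTheory.GaloisRepresentations.IsNonarchimedeanLocalField
open Literature.NumberTheory.PAdicHodge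
open Literature.NumberTheory.EllipticCurves Literature.NumberTheory.EllipticCurves.ModularForms
open Literature.NumberTheory.EllipticCurves.Kato2004 Literature.NumberTheory.EllipticCurves.Kato2004.EulerSystemValues
open Summit.BirchSwinnertonDyer.BirchSwinnertonDyer.Theorems.SemiLocalDescent
open Summit.BirchSwinnertonDyer.BirchSwinnertonDyer.Theorems.KatoNeronIsogenyTransport
open Summit.BirchSwinnertonDyer.BirchSwinnertonDyer.Theorems.KatoAssemblySocket
open Summit.BirchSwinnertonDyer.BirchSwinnertonDyer.Theorems.KatoCarayolFree
open Summit.BirchSwinnertonDyer.BirchSwinnertonDyer.Theorems.StarredOptimalManinUnitFiveSevenValueExit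
open Summit.BirchSwinnertonDyer.BirchSwinnertonDyer.Theorems.KimAtThreeDeepLowerExpStarOmega
open Summit.BirchSwinnertonDyer.BirchSwinnertonDyer.Theorems.KimAtThreeDeepLowerExpStarOmegaPlace
open Summit.BirchSwinnertonDyer.BirchSwinnertonDyer.Theorems.KimAtThreeDeepUpperTowerLattice
  (fact_natCast_mem_primesEquiv_symm)
open Rat.HeightOneSpectrum
open scoped NNReal
open Literature.NumberTheory.GaloisRepresentations.PeriodRingData
open Literature.NumberTheory.EllipticCurves.FormalGroupChart (padicLogPointFiniteExt)
open Summit.BirchSwinnertonDyer.BirchSwinnertonDyer.Theorems.KimAtThreeDeepLowerExpStarOmegaRes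
open Summit.BirchSwinnertonDyer.BirchSwinnertonDyer.Theorems.KimAtThreeDeepUpperExpStarTransport
open Summit.BirchSwinnertonDyer.BirchSwinnertonDyer.Theorems.KimAtThreeDeepUpperExpStarFacts
open Summit.BirchSwinnertonDyer.BirchSwinnertonDyer.Theorems.KimAtThreeDeepUpperExpStarFactsCanonical
open Summit.BirchSwinnertonDyer.Rank1Residual.GaloisImage
open Summit.BirchSwinnertonDyer.BirchSwinnertonDyer.Theorems.KatoAssemblySocketAt

-- FILE-LOCAL instance keys, byte-identical to the accepted `…SemiLocalIntegralityPinAt.lean` l.164–169 (no library instance is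
-- overridden outside this file): the `Fact (p ∈ v_p)` key and the local-field structures on `ℚ_v = Place.Completion (inr v_p)`,
-- under which the displayed hypothesis `hT₂V` (body of (S5b-tower) at `ℚ_v ⊆ ℚ(ζ_m)_w`) is stated.
attribute [local instance] fact_natCast_mem_primesEquiv_symm
attribute [local instance 100000] NumberField.Place.instAlgebraCompletion
attribute [local instance] valuativeRelPlace topologicalSpacePlace
attribute [local instance] isNonarchimedeanLocalField_place charZero_place
attribute [local instance] padicAlgebraPlace fact_not_isUnit_place isAdicComplete_place

set_option backward.isDefEq.respectTransparency false in
set_option maxHeartbeats 1600000 in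
/-- ★★ **F″ AT ONE ISOGENY CLASS ⟸ P1-bar ∧ (S5b-tower) AT THE MEMBERS OF THIS CLASS ∧ Prop. 1.2.3 ∧ «`V_pV|_{Γ_{ℚ_p}}` is de Rham».**
The statement of `KatoAssemblySocketAt.katoNeronBody_of_sl2NeronValuesBar_of_isDeRhamAt` VERBATIM, except that the ∀-fields cite fact
(S5b-tower) `hT₂` is replaced by the displayed `hT₂V`: for every globally minimal member `W′ ∼ V` (Kato's member of P1-bar is one) and every
place `w ∣ p` of `ℚ(ζ_m)`, the body of (S5b-tower) for `W′` at the tower `ℚ_v ⊆ ℚ(ζ_m)_w` (binders of `…TowerRangeAt.exists_smul_ranges_of_rangeAt`).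
Proof = the original's, with (INT) read through `…SemiLocalIntegralityOfRangeAt.semilocal_mem_adicCompletionIntegers_of_pin_of_semi_of_rangeAt`
at `W′` with `hT₂V W′ hiso`. CONDITIONAL on the displayed facts; nothing is closed.
[cite: Kato2004Asterisque, (8.1.3) (p. 180), §8.3 (p. 181), Thm. 9.7 (p. 189), Thm. 6.6 (1) (p. 163), Thm. 5.6 (p. 157), Thm. 13.6 (p. 227)]
[cite: Kato1993LNM1553, Ch. II Prop. 1.2.3, Ex. 1.3.5, Thm. 1.4.1 (3)–(4)] [cite: BlochKato1990, Prop. 3.8 and Example 3.11]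
[cite: KimNakamura2020, Cor. 2.4] [cite: GreenbergVatsal2000, §3 Remark 3.4] [cite: AtkinLehner1970, Thm. 3] -/
theorem katoNeronBody_of_sl2NeronValuesBar_of_rangeAt
    (hP : Literature.NumberTheory.PAdicHodge.cupLogInjective_and_hasDualExp_of_isDeRham)
    (hP1 : exists_member_sl2ZetaElement_neron_values_bar)
    (V : WeierstrassCurve ℚ) [V.IsElliptic] [V.IsGloballyMinimal] (p : ℕ) [hp : Fact p.Prime]
    (hDRV : ∀ (v : HeightOneSpectrum (𝓞 ℚ)), ((p : ℕ) : 𝓞 ℚ) ∈ v.asIdeal →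
      ∀ [CharZero (v.adicCompletion ℚ)] [Fact (¬ IsUnit (p : integerC (v.adicCompletion ℚ)))]
        [IsAdicComplete (Ideal.span {(p : integerC (v.adicCompletion ℚ))}) (integerC (v.adicCompletion ℚ))]
        (hp' : valuation (v.adicCompletion ℚ) p < 1) [Algebra ℚ_[p] (v.adicCompletion ℚ)],
        GaloisRep.IsDeRham (bdRPeriodRingData (F := v.adicCompletion ℚ) (p := p) hp')
          (restrictedRationalTateRep V (v.adicCompletion ℚ) p))
    {N : ℕ} [NeZero N] (f : CuspForm (Gamma0 N) 2) (hf : IsNewformOf V f) (hp5 : 5 ≤ p)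
    (hgood : ¬ V.HasGoodReductionAtPrime p) (hmult : ¬ V.HasMultiplicativeReductionAtPrime p)
    (hirr : V.HasIrreducibleModPGaloisRep p) (m : ℕ) [NeZero m] (hm : m.Coprime (p * N))
    -- (S5b-tower) AT EVERY MEMBER `W′ ∼ V` and every tower `ℚ_v ⊆ ℚ(ζ_m)_w`: the body of the cite fact, for this class only
    (hT₂V : ∀ (W' : WeierstrassCurve ℚ) [W'.IsElliptic] [W'.IsGloballyMinimal], WeierstrassCurve.IsIsogenous V W' →
      ∀ (w : ((primesEquiv (R := 𝓞 ℚ)).symm ⟨p, hp.out⟩).Extension (𝓞 (CyclotomicField m ℚ))), ∀ (hw : ((p : ℕ) : 𝓞 (CyclotomicField m ℚ)) ∈ w.1.asIdeal)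
          [CharZero (w.1.adicCompletion (CyclotomicField m ℚ))] [Fact (¬ IsUnit ((p : ℕ) : integerC (w.1.adicCompletion (CyclotomicField m ℚ))))]
          [IsAdicComplete (Ideal.span {((p : ℕ) : integerC (w.1.adicCompletion (CyclotomicField m ℚ)))}) (integerC (w.1.adicCompletion (CyclotomicField m ℚ)))]
          (hL : valuation (w.1.adicCompletion (CyclotomicField m ℚ)) ((p : ℕ) : (w.1.adicCompletion (CyclotomicField m ℚ))) < 1), letI := LocalField.adicCompletionPadicAlgebra w.1 p hw
        letI : Algebra (Place.Completion (K := ℚ) (Sum.inr ((primesEquiv (R := 𝓞 ℚ)).symm ⟨p, hp.out⟩))) (w.1.adicCompletion (CyclotomicField m ℚ)) :=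
          inferInstanceAs (Algebra (((primesEquiv (R := 𝓞 ℚ)).symm ⟨p, hp.out⟩).adicCompletion ℚ) (w.1.adicCompletion (CyclotomicField m ℚ)))
        ∀ (wv : Valuation (Place.Completion (Sum.inr ((primesEquiv (R := 𝓞 ℚ)).symm ⟨p, hp.out⟩) : Place ℚ)) ℝ≥0) [wv.Compatible]
            [(W'.baseChange (Place.Completion (Sum.inr ((primesEquiv (R := 𝓞 ℚ)).symm ⟨p, hp.out⟩) : Place ℚ))).IsIntegral wv.integer]
            (ν : Valuation (w.1.adicCompletion (CyclotomicField m ℚ)) ℝ≥0) [ν.Compatible] [(W'.baseChange (w.1.adicCompletion (CyclotomicField m ℚ))).IsIntegral ν.integer]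
            (d₀ : LocalNeronLineAt W' p ((primesEquiv (R := 𝓞 ℚ)).symm ⟨p, hp.out⟩)) (d : LocalNeronLine W' hL ((galRestrictPlace ((primesEquiv (R := 𝓞 ℚ)).symm ⟨p, hp.out⟩)).comp
              (absGaloisRestrict (Place.Completion (Sum.inr ((primesEquiv (R := 𝓞 ℚ)).symm ⟨p, hp.out⟩) : Place ℚ)) (w.1.adicCompletion (CyclotomicField m ℚ))))),
            (bdRPeriodRingData (valuation_place_lt_one p ((primesEquiv (R := 𝓞 ℚ)).symm ⟨p, hp.out⟩))).CupLogInjective (logCyclotomic p)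
              (localRationalTateRep W' p (galRestrictPlace ((primesEquiv (R := 𝓞 ℚ)).symm ⟨p, hp.out⟩))) →
            (∀ z : contOneCocycles (localRationalTateRep W' p (galRestrictPlace ((primesEquiv (R := 𝓞 ℚ)).symm ⟨p, hp.out⟩))).toTopRep,
              (bdRPeriodRingData (valuation_place_lt_one p ((primesEquiv (R := 𝓞 ℚ)).symm ⟨p, hp.out⟩))).HasDualExp (logCyclotomic p)
                (localRationalTateRep W' p (galRestrictPlace ((primesEquiv (R := 𝓞 ℚ)).symm ⟨p, hp.out⟩))) fun σ => z.1 σ) →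
            (bdRPeriodRingData (F := (w.1.adicCompletion (CyclotomicField m ℚ))) (p := p) hL).CupLogInjective (logCyclotomic p) (localRationalTateRep W' p
                ((galRestrictPlace ((primesEquiv (R := 𝓞 ℚ)).symm ⟨p, hp.out⟩)).comp (absGaloisRestrict (Place.Completion (Sum.inr ((primesEquiv (R := 𝓞 ℚ)).symm ⟨p, hp.out⟩) : Place ℚ)) (w.1.adicCompletion (CyclotomicField m ℚ))))) →
            (∀ z : contOneCocycles (localRationalTateRep W' p
                ((galRestrictPlace ((primesEquiv (R := 𝓞 ℚ)).symm ⟨p, hp.out⟩)).comp (absGaloisRestrict (Place.Completion (Sum.inr ((primesEquiv (R := 𝓞 ℚ)).symm ⟨p, hp.out⟩) : Place ℚ)) (w.1.adicCompletion (CyclotomicField m ℚ))))).toTopRep,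
              (bdRPeriodRingData (F := (w.1.adicCompletion (CyclotomicField m ℚ))) (p := p) hL).HasDualExp (logCyclotomic p) (localRationalTateRep W' p
                  ((galRestrictPlace ((primesEquiv (R := 𝓞 ℚ)).symm ⟨p, hp.out⟩)).comp (absGaloisRestrict (Place.Completion (Sum.inr ((primesEquiv (R := 𝓞 ℚ)).symm ⟨p, hp.out⟩) : Place ℚ)) (w.1.adicCompletion (CyclotomicField m ℚ)))))
                fun σ => z.1 σ) → (∀ (η₀ : contOneCocycles (restrictedTateRep W' (Place.Completion (Sum.inr ((primesEquiv (R := 𝓞 ℚ)).symm ⟨p, hp.out⟩) : Place ℚ)) p).toTopRep)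
                (ηT : contOneCocycles ((restrictedTateRep W' (Place.Completion (Sum.inr ((primesEquiv (R := 𝓞 ℚ)).symm ⟨p, hp.out⟩) : Place ℚ)) p).restrict
                  (absGaloisRestrict (Place.Completion (Sum.inr ((primesEquiv (R := 𝓞 ℚ)).symm ⟨p, hp.out⟩) : Place ℚ)) (w.1.adicCompletion (CyclotomicField m ℚ)))).toTopRep),
                (∀ σ, ηT.1 σ = η₀.1 (absGaloisRestrict (Place.Completion (Sum.inr ((primesEquiv (R := 𝓞 ℚ)).symm ⟨p, hp.out⟩) : Place ℚ)) (w.1.adicCompletion (CyclotomicField m ℚ)) σ)) →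
                expStarCoordTower W' (F₀ := (Place.Completion (Sum.inr ((primesEquiv (R := 𝓞 ℚ)).symm ⟨p, hp.out⟩) : Place ℚ))) hL d ηT =
                  algebraMap (Place.Completion (Sum.inr ((primesEquiv (R := 𝓞 ℚ)).symm ⟨p, hp.out⟩) : Place ℚ)) (w.1.adicCompletion (CyclotomicField m ℚ))
                    (expStarCoord W' (valuation_place_lt_one p ((primesEquiv (R := 𝓞 ℚ)).symm ⟨p, hp.out⟩)) d₀ η₀)) →
            ∃ (e : (Place.Completion (Sum.inr ((primesEquiv (R := 𝓞 ℚ)).symm ⟨p, hp.out⟩) : Place ℚ))) (he : e ≠ 0),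
              (∀ a₀ : (Place.Completion (Sum.inr ((primesEquiv (R := 𝓞 ℚ)).symm ⟨p, hp.out⟩) : Place ℚ)),
                (∃ η₀ : contOneCocycles (restrictedTateRep W' (Place.Completion (Sum.inr ((primesEquiv (R := 𝓞 ℚ)).symm ⟨p, hp.out⟩) : Place ℚ)) p).toTopRep,
                    expStarCoord W' (valuation_place_lt_one p ((primesEquiv (R := 𝓞 ℚ)).symm ⟨p, hp.out⟩)) (d₀.smul e he) η₀ = a₀) ↔
                  ∀ P : (W'.baseChange (Place.Completion (Sum.inr ((primesEquiv (R := 𝓞 ℚ)).symm ⟨p, hp.out⟩) : Place ℚ))).toAffine.Point,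
                    ‖Algebra.trace ℚ_[p] (Place.Completion (Sum.inr ((primesEquiv (R := 𝓞 ℚ)).symm ⟨p, hp.out⟩) : Place ℚ)) (a₀ * padicLogPointFiniteExt wv
                          (W'.baseChange (Place.Completion (Sum.inr ((primesEquiv (R := 𝓞 ℚ)).symm ⟨p, hp.out⟩) : Place ℚ))) p P)‖ ≤ 1) ∧ (∀ a : (w.1.adicCompletion (CyclotomicField m ℚ)),
                (∃ ηT : contOneCocycles ((restrictedTateRep W' (Place.Completion (Sum.inr ((primesEquiv (R := 𝓞 ℚ)).symm ⟨p, hp.out⟩) : Place ℚ)) p).restrict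
                    (absGaloisRestrict (Place.Completion (Sum.inr ((primesEquiv (R := 𝓞 ℚ)).symm ⟨p, hp.out⟩) : Place ℚ)) (w.1.adicCompletion (CyclotomicField m ℚ)))).toTopRep,
                    expStarCoordTower W' (F₀ := (Place.Completion (Sum.inr ((primesEquiv (R := 𝓞 ℚ)).symm ⟨p, hp.out⟩) : Place ℚ))) hL
                      (d.smul (algebraMap (Place.Completion (Sum.inr ((primesEquiv (R := 𝓞 ℚ)).symm ⟨p, hp.out⟩) : Place ℚ)) (w.1.adicCompletion (CyclotomicField m ℚ)) e)
                        ((map_ne_zero (algebraMap (Place.Completion (Sum.inr ((primesEquiv (R := 𝓞 ℚ)).symm ⟨p, hp.out⟩) : Place ℚ)) (w.1.adicCompletion (CyclotomicField m ℚ)))).mpr he)) ηT = a) ↔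
                  ∀ P : (W'.baseChange (w.1.adicCompletion (CyclotomicField m ℚ))).toAffine.Point,
                    ‖Algebra.trace ℚ_[p] (w.1.adicCompletion (CyclotomicField m ℚ)) (a * padicLogPointFiniteExt ν (W'.baseChange (w.1.adicCompletion (CyclotomicField m ℚ))) p P)‖ ≤ 1))
    (htors : 7 < p ∨ (Nat.Coprime (orderOf (p : ZMod m)) (p - 1) ∧
      ∀ P : (V.baseChange ℚ_[p]).toAffine.Point, p • P = 0 → P = 0))
    (χ : DirichletCharacter ℂ m) (hχ : χ.IsPrimitive) (hχ1 : χ ≠ 1) (hord : ¬ p ∣ orderOf χ)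
    (ϖ : ℚ) (r : ℂ) :
    (χ.Even → (ϖ : ℝ) * V.realPeriodRat = plusPeriod f →
        (∏ ℓ ∈ N.primeFactors with ¬ ℓ ^ 2 ∣ N,
            (((ℓ : ℂ) - (V.LFunction ℓ : ℂ) * χ (ℓ : ZMod m)) *
              ((ℓ : ℂ) - (V.LFunction ℓ : ℂ) * (χ (ℓ : ZMod m))⁻¹))) *
            twistedSymbolSum f χ = r * (plusPeriod f : ℂ) →
        ∃ s : ℕ, ¬ p ∣ s ∧ IsIntegral ℤ ((s : ℂ) * ϖ * r)) ∧
      (χ.Odd → (ϖ : ℝ) * V.imaginaryPeriodRat = minusPeriod f →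
        (∏ ℓ ∈ N.primeFactors with ¬ ℓ ^ 2 ∣ N,
            (((ℓ : ℂ) - (V.LFunction ℓ : ℂ) * χ (ℓ : ZMod m)) *
              ((ℓ : ℂ) - (V.LFunction ℓ : ℂ) * (χ (ℓ : ZMod m))⁻¹))) *
            twistedSymbolSum f χ = r * (minusPeriod f : ℂ) * Complex.I →
        ∃ s : ℕ, ¬ p ∣ s ∧ IsIntegral ℤ ((s : ℂ) * ϖ * r)) := by
  -- P1-bar at `(V, p)`: Kato's member `W′ ∼ V`, the Néron-pinned line datum `d₀`, the coordinate `n`, the level data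
  obtain ⟨W', hW'E, hW'M, hiso, hW'⟩ := hP1 V p
  letI : ContinuousSMul ℤ_[p] (W'.tateModule p) := TateModule.continuousSMul_padicInt
  haveI : Module.Free ℤ_[p] (W'.tateModule p) := W'.module_free_tateModule_holds p
  haveI : Module.Finite ℤ_[p] (W'.tateModule p) := W'.module_finite_tateModule_holds p
  obtain ⟨d₀, hPIN, n, hn, hm'⟩ := hW' f hf
  obtain ⟨ι, Λ, hSEMI, hval⟩ := hm' m
  obtain ⟨Ψ, hΨ⟩ := Literature.NumberTheory.AdelicBaseChange.exists_padicTensorAlgEquiv (CyclotomicField m ℚ) p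
  -- the member's own copy of F″'s hypotheses (P6 `hyps_of_isIsogenous`)
  obtain ⟨hfW, hgoodW, hmultW, hirrW, htorsW⟩ := hyps_of_isIsogenous hiso hf hgood hmult hirr htors
  have hp2 : p ≠ 2 := by omega
  -- de Rham at `V` in the `ℚ_v`-keys of the Pin file (`v = (p)`): the hypothesis at the file-local structures of
  -- `KimAtThreeDeepLowerExpStarOmegaPlace` (plain definitions, passed explicitly — no instance is registered here) …
  have h0 := @hDRV ((primesEquiv (R := 𝓞 ℚ)).symm ⟨p, hp.out⟩) (fact_natCast_mem_primesEquiv_symm p).out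
    (charZero_place _) (@fact_not_isUnit_place p _ (fact_natCast_mem_primesEquiv_symm p))
    (@isAdicComplete_place p _ _ (fact_natCast_mem_primesEquiv_symm p))
    (@valuation_place_lt_one p _ (fact_natCast_mem_primesEquiv_symm p))
    (@padicAlgebraPlace p _ _ (fact_natCast_mem_primesEquiv_symm p))
  -- … read for the tree's `ℚ`-algebra structure `Place.instAlgebraCompletion` on `ℚ_v` (any two `ℚ`-algebra structures
  -- on a ring coincide, so the restricted representation does not depend on the choice) …
  have hrep : ∀ (i₁ i₂ : Algebra ℚ (((primesEquiv (R := 𝓞 ℚ)).symm ⟨p, hp.out⟩).adicCompletion ℚ)),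
      @restrictedRationalTateRep ℚ _ V _ _ i₁ p _ _ = @restrictedRationalTateRep ℚ _ V _ _ i₂ p _ _ :=
    fun i₁ i₂ ↦ by rw [Subsingleton.elim i₁ i₂]
  have h1 := (hrep (@DivisionRing.toRatAlgebra _ _ (charZero_place _))
    (Place.instAlgebraCompletion (Sum.inr ((primesEquiv (R := 𝓞 ℚ)).symm ⟨p, hp.out⟩) : Place ℚ))) ▸ h0
  -- … and moved to the member `W′` along `V ∼ W′` (`DeRhamEllipticIsogeny`)
  have hDRW := @isDeRham_restrictedRationalTateRep_of_isIsogenous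
    (Place.Completion (Sum.inr ((primesEquiv (R := 𝓞 ℚ)).symm ⟨p, hp.out⟩) : Place ℚ)) _
    (valuativeRelPlace _) (topologicalSpacePlace _) (isNonarchimedeanLocalField_place _) (charZero_place _) p _
    (@fact_not_isUnit_place p _ (fact_natCast_mem_primesEquiv_symm p))
    (@isAdicComplete_place p _ _ (fact_natCast_mem_primesEquiv_symm p))
    (@valuation_place_lt_one p _ (fact_natCast_mem_primesEquiv_symm p))
    (@padicAlgebraPlace p _ _ (fact_natCast_mem_primesEquiv_symm p)) ℚ _ _
    (Place.instAlgebraCompletion _) V W' _ hW'E hiso h1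
  -- (INT): every semi-local value `Ψ (Λ y) w` is a `w`-adic integer — P4-coh PER CURVE at the member
  have hint : ∀ (y : H1 (tateRep W' p) (rootsOfUnityFixer ℚ m))
      (w : ((primesEquiv (R := 𝓞 ℚ)).symm ⟨p, hp.out⟩).Extension (𝓞 (CyclotomicField m ℚ))),
      Ψ (Λ y) w ∈ w.1.adicCompletionIntegers (CyclotomicField m ℚ) := fun y w ↦
    StarredOptimalManinUnitFiveSevenSemiLocalIntegralityOfRangeAt.semilocal_mem_adicCompletionIntegers_of_pin_of_semi_of_rangeAt
      p hP W' hDRW hp5 ⟨hgoodW, hmultW⟩ d₀ hPIN m (not_dvd_of_coprime_mul hm) htorsW Λ Ψ (hSEMI Ψ hΨ)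
      (hT₂V W' hiso) y w
  -- the member value law with `p`-integral character sum (body of `memberValueLaw_of_integralSL2NeronValues`)
  have hVL : ∀ (L : ℂ → ℂ), EulerSystemValues.IsDepletedTwistedL f m (p * N) χ⁻¹ L →
      ∀ c d : ℕ,
      (1 < c ∧ c ≡ 1 [MOD N] ∧ c ≡ 1 [MOD p] ∧ (p : ℤ) ∣ (c : ℤ) - 1 ∧ c.Coprime (6 * (m * (p * N))) ∧
        IsUnit (c : ZMod m) ∧ χ (c : ZMod m) ≠ 1) →
      (1 < d ∧ d ≡ 1 [MOD N] ∧ d ≡ 1 [MOD p] ∧ (p : ℤ) ∣ (d : ℤ) - 1 ∧ d.Coprime (6 * (m * (p * N))) ∧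
        IsUnit (d : ZMod m) ∧ χ (d : ZMod m) ≠ 1) →
      ∃ (q : ℚ) (y μ ν : ℂ), ¬ (p : ℤ) ∣ q.num ∧ (∃ s : ℕ, ¬ p ∣ s ∧ IsIntegral ℤ ((s : ℂ) * y)) ∧
        (μ = χ (c : ZMod m) ∨ μ = χ⁻¹ (c : ZMod m)) ∧ (ν = χ (d : ZMod m) ∨ ν = χ⁻¹ (d : ZMod m)) ∧
        (χ.Even → y = ((c : ℂ) ^ 2 - (c : ℂ) * μ) * ((d : ℂ) ^ 2 - (d : ℂ) * ν) * (q : ℂ) *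
          (L 1 / (W'.realPeriodRat : ℂ))) ∧
        (χ.Odd → y = ((c : ℂ) ^ 2 - (c : ℂ) * μ) * ((d : ℂ) ^ 2 - (d : ℂ) * ν) * (q : ℂ) *
          (L 1 / (Complex.I * (W'.imaginaryPeriodRat : ℂ)))) := by
    intro L hL c d hc hd
    obtain ⟨-, hcN, -, -, hccop, -, -⟩ := hc
    obtain ⟨-, hdN, -, -, hdcop, -, -⟩ := hd
    -- Kato's guards for `(c, d)` in the P1 text's `ℤ`-currency
    have hcZ : (c : ℤ) ≡ 1 [ZMOD (N : ℤ)] := intModEq_one_of_natModEq_one hcN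
    have hdZ : (d : ℤ) ≡ 1 [ZMOD (N : ℤ)] := intModEq_one_of_natModEq_one hdN
    have hgcd : Int.gcd ((c : ℤ) * (d : ℤ)) (6 * (p : ℤ) * (m : ℤ)) = 1 := int_gcd_mul_eq_one_of_coprime hccop hdcop
    -- the parity of `χ` decides the sign `b` at which the Manin-symbol coordinate is taken
    by_cases hev : χ.Even
    · obtain ⟨ξ, hnξ0, hnξv⟩ := hn hp2 true
      obtain ⟨z, x, hΛz, hlaw⟩ := hval (c : ℤ) (d : ℤ) ξ hcZ hdZ hgcd
      obtain ⟨hlawE, -⟩ := hlaw χ⁻¹ L hL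
      have hE : χ⁻¹ (-1) = 1 := (inv_apply_neg_one_eq_one_iff χ).2 hev
      have hlawE' := hlawE hE
      refine ⟨n ξ true, charSum m ι χ⁻¹ x, χ (c : ZMod m), χ (d : ZMod m),
        not_dvd_num_of_padicValRat_eq_zero hnξ0 hnξv,
        exists_not_dvd_isIntegral_charSum_of_forall_semilocal_mem m p Ψ hΨ x (Λ z) hΛz (hint z) ι χ⁻¹,
        Or.inl rfl, Or.inl rfl, fun _ ↦ ?_, fun hod ↦ ?_⟩
      · rw [hlawE']
        simp only [inv_inv_apply]
        push_cast
        ring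
      · exfalso
        have h1 : χ (-1) = 1 := hev
        have h2 : χ (-1) = -1 := hod
        rw [h1] at h2
        norm_num at h2
    · obtain ⟨ξ, hnξ0, hnξv⟩ := hn hp2 false
      obtain ⟨z, x, hΛz, hlaw⟩ := hval (c : ℤ) (d : ℤ) ξ hcZ hdZ hgcd
      obtain ⟨-, hlawO⟩ := hlaw χ⁻¹ L hL
      refine ⟨n ξ false, charSum m ι χ⁻¹ x, χ (c : ZMod m), χ (d : ZMod m),
        not_dvd_num_of_padicValRat_eq_zero hnξ0 hnξv,
        exists_not_dvd_isIntegral_charSum_of_forall_semilocal_mem m p Ψ hΨ x (Λ z) hΛz (hint z) ι χ⁻¹,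
        Or.inl rfl, Or.inl rfl, fun hev' ↦ absurd hev' hev, fun hod ↦ ?_⟩
      have hO : χ⁻¹ (-1) = -1 := (inv_apply_neg_one_eq_neg_one_iff χ).2 hod
      rw [hlawO hO]
      simp only [inv_inv_apply]
      push_cast
      ring
  -- the value exit at the member (body of `kato_neron_five_le_of_memberValueLaw'`): level facts from the Fourier
  -- coefficients, the entire continuation of the `(m·pN)`-inflated series of `χ̄`, the depleted value, NIV ⟹ F″ at `W′`
  have hpN : p ∣ N := dvd_level_of_isNewformOf_of_not_good_of_not_mult W' hfW hgoodW hmultW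
  have hsq := forall_lFunction_eq_zero_of_sq_dvd_level W' hfW
  haveI : NeZero (m * (p * N)) :=
    ⟨mul_ne_zero (NeZero.ne m) (mul_ne_zero (Fact.out : p.Prime).ne_zero (NeZero.ne N))⟩
  obtain ⟨L, hLd, hLs⟩ := exists_differentiable_eq_twistedLSeries_holds f
    (DirichletCharacter.changeLevel (dvd_mul_right m (p * N)) χ⁻¹)
  have hL : EulerSystemValues.IsDepletedTwistedL f m (p * N) χ⁻¹ L := ⟨hLd, hLs⟩
  obtain ⟨heven, hodd⟩ := depletedValueIntegral_of_memberValueLaw W' f hm χ hχ1 hord hVL L hL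
  have hbodyW : ∀ (ϖ : ℚ) (r : ℂ),
      (χ.Even → (ϖ : ℝ) * W'.realPeriodRat = plusPeriod f →
        (∏ ℓ ∈ N.primeFactors with ¬ ℓ ^ 2 ∣ N,
            (((ℓ : ℂ) - (W'.LFunction ℓ : ℂ) * χ (ℓ : ZMod m)) *
              ((ℓ : ℂ) - (W'.LFunction ℓ : ℂ) * (χ (ℓ : ZMod m))⁻¹))) *
            twistedSymbolSum f χ = r * (plusPeriod f : ℂ) →
        ∃ s : ℕ, ¬ p ∣ s ∧ IsIntegral ℤ ((s : ℂ) * ϖ * r)) ∧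
      (χ.Odd → (ϖ : ℝ) * W'.imaginaryPeriodRat = minusPeriod f →
        (∏ ℓ ∈ N.primeFactors with ¬ ℓ ^ 2 ∣ N,
            (((ℓ : ℂ) - (W'.LFunction ℓ : ℂ) * χ (ℓ : ZMod m)) *
              ((ℓ : ℂ) - (W'.LFunction ℓ : ℂ) * (χ (ℓ : ZMod m))⁻¹))) *
            twistedSymbolSum f χ = r * (minusPeriod f : ℂ) * Complex.I →
        ∃ s : ℕ, ¬ p ∣ s ∧ IsIntegral ℤ ((s : ℂ) * ϖ * r)) := fun ϖ₁ r₁ ↦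
    ⟨fun hev hϖ hr ↦ katoNeron_even_of_depletedValue W' hfW hpN hsq hm hχ hL (heven hev) hϖ hr,
      fun hod hϖ hr ↦ katoNeron_odd_of_depletedValue W' hfW hpN hsq hm hχ hL (hodd hod) hϖ hr⟩
  -- P6: back to `V` along the prime-to-`p` isogeny (`V[p]` irreducible)
  exact body_of_isIsogenous hiso hirr hf χ hbodyW ϖ r

end Summit.BirchSwinnertonDyer.BirchSwinnertonDyer.Theorems.StarredOptimalManinUnitFiveSevenAssemblyAtBarOfRangeAt

end
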